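import Literature.AlgebraicGeometry.Motives.JouanolouTorsorChart
import Literature.AlgebraicGeometry.HodgeTheory.JouanolouDeviceCohomology
import HarnessLib

/-!
# Jouanolou's device holds: discharge of `jouanolou_affineTorsor` and of (J)

Topic `Literature/AlgebraicGeometry/HodgeTheory`; theorems only, no named facts. This file closes the
named fact `jouanolou_affineTorsor` of `HodgeTheory/JouanolouDeviceCohomology` — a smooth projective
`X/ℂ` receives a `ℂ`-morphism `π : Y ⟶ X` from a smooth AFFINE `Y` which is, Zariski-locally on `X`,
the projection `V × 𝔸ʳ → V` (`IsZariskiLocallyAffineProduct`) — by Jouanolou's construction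
(Jouanolou 1973, Lemme 1.5; Gillet, LNM 1491 §6.2 p. 82) in the incidence-complement form carried out
in `Motives/JouanolouTorsor`, `Motives/JouanolouTorsorChartRing`, `Motives/JouanolouTorsorChart`:
for a closed immersion `ι : X ↪ ℙᴺ`, `Y = {(x, a) | Σᵢ aᵢ xᵢ(x) ≠ 0} ⊆ X ×_ℂ (ℙᴺ)^*` (pairs: point of
`X`, hyperplane not through it) with `π = pr₁`;

* `Y` is affine (a closed subscheme of the affine complement of the incidence divisor, a hyperplane
  section of the Segre variety) and smooth over `ℂ` of relative dimension `n + N`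
  (`JouanolouTorsor.isAffine_left`, `JouanolouTorsor.smoothOfRelativeDimension_hom'`);
* over an affine open `X' ⊆ X ∩ D₊(x_j)` the torsor is trivial: the chart
  `ψ : X' × 𝔸ᴺ ⟶ Y`, `(x, t) ↦ (x, [a(x, t)])` with the moving hyperplane `a` (`a_j = 1 - Σ_{i≠j} uᵢtᵢ`,
  `aᵢ = tᵢ`, `uᵢ = xᵢ/x_j`) is an open immersion over `X` onto `π⁻¹X'`
  (`JouanolouTorsor.toTorsor`, `isOpenImmersion_toTorsor_left`, `range_toTorsor_left`, `toTorsor_proj`).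

§1 identifies `X' × 𝔸ᴺ = Spec Γ(X, X')[t₁, …, t_N]` with the product `Spec Γ(X, X') ⊗ 𝔸ᴺ_ℂ` of
`ℂ`-schemes (Mathlib `AffineSpace.SpecIso`, `AffineSpace.isPullback_map`); §2 assembles
`IsZariskiLocallyAffineProduct (JouanolouTorsor.proj N ι) N` for every `ι : X ⟶ ℙᴺ_ℂ`
(`isZariskiLocallyAffineProduct_proj`) and the discharge `jouanolou_affineTorsor_holds`; §3 records the
consequences already reduced to it in `JouanolouDeviceCohomology`: the cohomological form (J)
`jouanolou_cohomologyChart_holds` (discharging the named fact of `ConjugationChartExistence`),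
unconditional existence of conjugation charts `nonempty_conjugationChart`, and existence of conjugate
classes from (G) and (C) alone (`exists_isConjugateClass_of_comparison`).

## References

* J.-P. Jouanolou, *Une suite exacte de Mayer–Vietoris en K-théorie algébrique*, LNM 341 (1973),
  Lemme 1.5. [Jouanolou1973]
* H. Gillet, *K-theory and intersection theory* §6.2 p. 82, in *Higher Algebraic K-Theory: an
  overview*, LNM 1491 (1992). [LluispueblaEtAl1992]
* R. Hartshorne, *Algebraic Geometry* (1977), II.3 Thm. 3.3 (fibre products), II Thm. 7.1.
  [Hartshorne1977]
-/

noncomputable section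

open CategoryTheory CategoryTheory.Limits AlgebraicGeometry MonoidalCategory TopologicalSpace
open Literature.NumberTheory.Transcendental
open Literature.AlgebraicGeometry.Motives

namespace Literature.AlgebraicGeometry.HodgeTheory

section HodgeTheory

-- `MvPolynomial.gradedAlgebra` is a `def` in Mathlib (no global instance), cf. `Motives/SegreEmbedding`;
-- `sectionsAlgebra` is the file-local `k`-algebra structure on `Γ(X, U)` of `Motives/UniversalHyperplaneSectionChart`.
attribute [local instance] MvPolynomial.gradedAlgebra UniversalHyperplaneSection.sectionsAlgebra

/-! ### §1 `Spec R[t₁, …, t_N] ≅ Spec R ×_ℂ 𝔸ᴺ_ℂ` -/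

section Polynomial

variable (N : ℕ) (R : Type) [CommRing R] [Algebra ℂ R]

/-- The isomorphism of schemes `Spec R[t₁, …, t_N] ≅ Spec R ×_ℂ 𝔸ᴺ_ℂ`: Mathlib's `𝔸ᴺ_{Spec R} ≅ Spec R[t]`
(`AffineSpace.SpecIso`) and the cartesian square `𝔸ᴺ_{Spec R} → 𝔸ᴺ_ℂ` over `Spec R → Spec ℂ`
(`AffineSpace.isPullback_map`). [cite: Hartshorne1977, II.3 Thm. 3.3] -/
def polynomialSpecIso :
    Spec (.of (MvPolynomial (Fin N) R)) ≅
      pullback (Spec.map (CommRingCat.ofHom (algebraMap ℂ R)))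
        (𝔸(Fin N; Spec (.of ℂ)) ↘ Spec (.of ℂ)) :=
  (AffineSpace.SpecIso (Fin N) (.of R)).symm ≪≫
    (AffineSpace.isPullback_map (n := Fin N)
      (Spec.map (CommRingCat.ofHom (algebraMap ℂ R)))).flip.isoPullback

/-- `polynomialSpecIso` followed by the projection to `Spec R` is `Spec` of `R → R[t]`.
[cite: Hartshorne1977, II.3 Thm. 3.3] -/
@[reassoc]
theorem polynomialSpecIso_hom_fst :
    (polynomialSpecIso N R).hom ≫ pullback.fst _ _ = Spec.map (CommRingCat.ofHom MvPolynomial.C) := by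
  rw [polynomialSpecIso, Iso.trans_hom, Iso.symm_hom, Category.assoc, IsPullback.isoPullback_hom_fst,
    AffineSpace.SpecIso_inv_over]

end Polynomial

/-! ### §2 Jouanolou's torsor is Zariski-locally on `X` the product with `𝔸ᴺ` -/

section Torsor

variable {N : ℕ} {X : SchemeOver ℂ} (ι : X ⟶ projectiveSpace N ℂ) (X' : X.left.affineOpens)

/-- An affine open `X' ⊆ X` as the `ℂ`-scheme `V = Spec Γ(X, X')` with its morphism `V ⟶ X`
(`IsAffineOpen.fromSpec`). [cite: Hartshorne1977, II Prop. 2.2 and Ex. 2.3.4] -/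
def affineOpenIncl : specOver ℂ Γ(X.left, (X' : X.left.Opens)) ⟶ X :=
  Over.homMk X'.2.fromSpec (by
    -- (restate with the source `Spec Γ(X, X')` syntactically, so that `fromSpec_comp_hom` rewrites)
    change X'.2.fromSpec ≫ X.hom =
      Spec.map (CommRingCat.ofHom (algebraMap ℂ Γ(X.left, (X' : X.left.Opens))))
    rw [UniversalHyperplaneSection.fromSpec_comp_hom X'.2, UniversalHyperplaneSection.algebraMap_sections])

/-- Unfolding of `affineOpenIncl` (`rfl`). [cite: Hartshorne1977, II Prop. 2.2] -/
theorem affineOpenIncl_left : (affineOpenIncl X').left = X'.2.fromSpec := rfl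

/-- `V = Spec Γ(X, X') ⟶ X` is an open immersion. [cite: Hartshorne1977, II Prop. 2.2] -/
instance isOpenImmersion_affineOpenIncl_left : IsOpenImmersion (affineOpenIncl X').left :=
  inferInstanceAs (IsOpenImmersion X'.2.fromSpec)

/-- The image of `V = Spec Γ(X, X') ⟶ X` is `X'`. [cite: Hartshorne1977, II Prop. 2.2] -/
theorem range_affineOpenIncl_left_base :
    Set.range (affineOpenIncl X').left.base = ((X' : X.left.Opens) : Set X.left) :=
  X'.2.range_fromSpec

variable (N) in
/-- **`W = X' × 𝔸ᴺ = Spec Γ(X, X')[t₁, …, t_N]` is the product `V ⊗ 𝔸ᴺ_ℂ` of `ℂ`-schemes**,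
`V = Spec Γ(X, X')`. [cite: Hartshorne1977, II.3 Thm. 3.3] -/
def chartSrcIso :
    JouanolouTorsor.chartSrc N X' ≅
      specOver ℂ Γ(X.left, (X' : X.left.Opens)) ⊗ affineSpaceOver (Fin N) ℂ :=
  Over.isoMk (polynomialSpecIso N Γ(X.left, (X' : X.left.Opens))) (by
    change (polynomialSpecIso N Γ(X.left, (X' : X.left.Opens))).hom ≫ pullback.fst _ _ ≫
        Spec.map (CommRingCat.ofHom (algebraMap ℂ Γ(X.left, (X' : X.left.Opens)))) =
      Spec.map (CommRingCat.ofHom (algebraMap ℂ (JouanolouTorsor.chartSrcRing N X')))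
    rw [polynomialSpecIso_hom_fst_assoc, ← Spec.map_comp, ← CommRingCat.ofHom_comp,
      IsScalarTower.algebraMap_eq ℂ Γ(X.left, (X' : X.left.Opens)) (JouanolouTorsor.chartSrcRing N X'),
      MvPolynomial.algebraMap_eq])

variable (N) in
/-- Under `W ≅ V ⊗ 𝔸ᴺ`, the first projection followed by `V ⟶ X` is `W = Spec Γ(X, X')[t] → X' ⊆ X`
(`JouanolouTorsor.toBase`). [cite: Hartshorne1977, II.3 Thm. 3.3] -/
theorem chartSrcIso_hom_fst_affineOpenIncl :
    (chartSrcIso N X').hom ≫ CartesianMonoidalCategory.fst _ _ ≫ affineOpenIncl X' =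
      JouanolouTorsor.toBase N X' := by
  apply Over.OverMorphism.ext
  change (polynomialSpecIso N Γ(X.left, (X' : X.left.Opens))).hom ≫ pullback.fst _ _ ≫ X'.2.fromSpec =
    (JouanolouTorsor.toBase N X').left
  rw [polynomialSpecIso_hom_fst_assoc, JouanolouTorsor.toBase_left, MvPolynomial.algebraMap_eq]

/-- **Jouanolou's torsor `π : Y ⟶ X` is, Zariski-locally on `X`, the product with `𝔸ᴺ`**: every
`x ∈ X` has an affine open neighbourhood `X' ⊆ X ∩ D₊(x_j)` (for a coordinate `x_j` not vanishing
at `ι x`), and over it `π⁻¹ X' ≅ X' × 𝔸ᴺ` via the chart `ψ` of `Motives/JouanolouTorsorChart`.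
[cite: Jouanolou1973, Lemme 1.5] [cite: LluispueblaEtAl1992, Gillet §6.2 p. 82] -/
theorem isZariskiLocallyAffineProduct_proj :
    IsZariskiLocallyAffineProduct (JouanolouTorsor.proj N ι) N := by
  intro x
  -- a standard chart `D₊(x_j)` of `ℙᴺ` containing `ι x` (retyped as a point of `Proj _`)
  set p : ↥(Proj (Segre.grading (Fin (N + 1)) ℂ)) := ι.left x with hp
  have hp' : p ∈ (⊤ : (Proj (Segre.grading (Fin (N + 1)) ℂ)).Opens) := trivial
  rw [← Proj.iSup_basicOpen_eq_top (Segre.grading (Fin (N + 1)) ℂ) (fun l ↦ MvPolynomial.X l)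
    (Segre.irrelevant_le_span_X (Fin (N + 1)) ℂ), Opens.mem_iSup] at hp'
  obtain ⟨j, hj⟩ := hp'
  -- an affine open neighbourhood `x ∈ X' ⊆ ι⁻¹ D₊(x_j)`
  obtain ⟨U, hU, hxU, hUle⟩ := Opens.isBasis_iff_nbhd.mp X.left.isBasis_affineOpens
    (show x ∈ ι.left ⁻¹ᵁ Proj.basicOpen (Segre.grading (Fin (N + 1)) ℂ) (MvPolynomial.X j) from hj)
  have hX' : ((⟨U, hU⟩ : X.left.affineOpens) : X.left.Opens) ≤
      ι.left ⁻¹ᵁ Proj.basicOpen (Segre.grading (Fin (N + 1)) ℂ) (MvPolynomial.X j) := hUle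
  refine ⟨specOver ℂ Γ(X.left, ((⟨U, hU⟩ : X.left.affineOpens) : X.left.Opens)),
    JouanolouTorsor.chartSrc N ⟨U, hU⟩, affineOpenIncl ⟨U, hU⟩, JouanolouTorsor.toTorsor ι j ⟨U, hU⟩ hX',
    inferInstance, inferInstance, chartSrcIso N ⟨U, hU⟩, ?_, ?_, ?_⟩
  · rw [range_affineOpenIncl_left_base]
    exact hxU
  · rw [range_affineOpenIncl_left_base]
    exact JouanolouTorsor.preimage_proj_subset_range_toTorsor ι j ⟨U, hU⟩ hX'
  · rw [chartSrcIso_hom_fst_affineOpenIncl, JouanolouTorsor.toTorsor_proj]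

end Torsor

/-- **Jouanolou's device holds** (discharge of the named fact `jouanolou_affineTorsor`): a smooth
projective `X/ℂ` of dimension `n`, embedded by `ι : X ↪ ℙᴺ`, receives `π : Y ⟶ X` from the smooth affine
`Y = {(x, a) | Σᵢ aᵢ xᵢ(x) ≠ 0} ⊆ X ×_ℂ (ℙᴺ)^*` of relative dimension `n + N`, Zariski-locally on `X` the
product with `𝔸ᴺ`. [cite: Jouanolou1973, Lemme 1.5] [cite: LluispueblaEtAl1992, Gillet §6.2 p. 82] -/
theorem jouanolou_affineTorsor_holds : jouanolou_affineTorsor := by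
  intro n X hX
  obtain ⟨N, ι, hι⟩ := hX.isProjectiveOver
  haveI := hX.smoothOfRelativeDimension
  exact ⟨n + N, N, jouanolouTorsor N ι, inferInstance,
    JouanolouTorsor.smoothOfRelativeDimension_hom' N ι n, JouanolouTorsor.proj N ι,
    isZariskiLocallyAffineProduct_proj ι⟩

/-! ### §3 Consequences: (J), conjugation charts, conjugate classes -/

/-- **(J) holds**: the named fact `jouanolou_cohomologyChart` of `ConjugationChartExistence` — a smooth
affine `Y` with `π : Y ⟶ X` such that `π^*` and all `(π^σ)^*` are bijective on `Hᵏ(–(ℂ); ℂ)` — is a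
theorem (`jouanolou_cohomologyChart_of_affineTorsor`). [cite: Jouanolou1973, Lemme 1.5] -/
theorem jouanolou_cohomologyChart_holds : jouanolou_cohomologyChart :=
  jouanolou_cohomologyChart_of_affineTorsor jouanolou_affineTorsor_holds

/-- **Conjugation charts exist unconditionally**: for `X` smooth projective over `ℂ`, `σ ∈ Aut ℂ` and
every degree `k` there is a conjugation chart. [cite: Jouanolou1973, Lemme 1.5] -/
theorem nonempty_conjugationChart {n : ℕ} {X : SchemeOver ℂ} (hX : IsSmoothProjective n X)
    (σ : ℂ ≃+* ℂ) (k : ℕ) : Nonempty (ConjugationChart σ X k) :=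
  nonempty_conjugationChart_of_affineTorsor jouanolou_affineTorsor_holds hX σ k

/-- **Conjugate classes exist from Grothendieck's comparison (G) and the closedness of conjugate
forms (C) alone** ((J) and (R) being theorems). [cite: CharlesSchnell2014Notes, §11.2.2 (11.2.3)] -/
theorem exists_isConjugateClass_of_comparison (hG : grothendieck_comparison_realize_surjective)
    (hC : conj_realize_mem_cclosedSmoothForms) :
    ∀ ⦃n : ℕ⦄ ⦃X : SchemeOver ℂ⦄, IsSmoothProjective n X →
      ∀ (σ : ℂ ≃+* ℂ) (k : ℕ) (c : complexBetti X k), ∃ c', IsConjugateClass σ X k c c' :=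
  exists_isConjugateClass_of_affineTorsor jouanolou_affineTorsor_holds hG hC

end HodgeTheory

end Literature.AlgebraicGeometry.HodgeTheory

end
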